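import Summits.KontsevichZagierPeriods.KontsevichZagierPeriods.Theses.AyoubSpecialisation
import Summits.KontsevichZagierPeriods.KontsevichZagierPeriods.Theses.LiftingCriteria
import Summits.KontsevichZagierPeriods.KontsevichZagierPeriods.Theorems.FurushoPentagonSectorToKernelResolvedRing
import Summits.KontsevichZagierPeriods.KontsevichZagierPeriods.Theorems.HurwitzMicroSectorsNormalFormPrinciplePiBoxTower
import Summits.KontsevichZagierPeriods.KontsevichZagierPeriods.Theorems.HurwitzMicroSectorsNormalFormPrincipleStubPiCalibration
import Summits.KontsevichZagierPeriods.KontsevichZagierPeriods.Theorems.VietaFibreKernelFormItemDictionary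
import Literature.NumberTheory.Transcendental.KZCubicalCalculus
import Literature.NumberTheory.Transcendental.KZProduct
import Literature.NumberTheory.Transcendental.KZProductIdeal

/-!
# Birth skeleton for child 1 of the `[π]`-split of `MultiCoVKernel` (stmt-2873):
# `AyoubPiLocalKernel` (item stmt-KontsevichZagierPeriods-0541), line `picut-localkernel`

Crux-strategist (unit `cstrat-stmt-KontsevichZagierPeriods-2873-r1`). The item is shared by routes
AyoubSpecialisation / HurwitzMicroSectors / LiouvilleUnfolding / AttractorUnfolding / MultivaluedCoV
(rev 2) with byte-identical bodies; this skeleton concludes it under its oldest name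
`AyoubSpecialisation.AyoubPiLocalKernel` (the MultivaluedCoV copy is the same term after `unfold`).

LINE. `π`-local kernel ⟸ (S1) cube-Nash normal form ∧ (S2) Ayoub's Conjecture 7 IN AYOUB'S OWN
PRESENTATION (real form): a `ℤ`-combination of tame cube classes of value `0` lies, after finitely many
left multiplications by the arctangent kernel `κ = [[0,1], du/((1−u)²+u²)]` (`[π] ≡ 2[κ]`, landed
`stub_piCalibration`), in the module generated by ℚ-LINEARITY of the integrand and STOKES on cubes alone
(`ayoubIdeal := ⟨KZ.cubicalLinGens ∪ KZ.cubicalStokesGens⟩`, Ayoub 2014 Def. 10; no change of variables,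
no subdivision). The point of the cut: the hypothesis `eval a = 0` is presentation-independent, so — unlike
cancellation / reducedness statements — NO comparison KZ ⇒ Ayoub is needed; S2 is the printed conjecture
verbatim (Ayoub 2014 Conj. 7: `Ev : 𝒫^eff_KZ[2πi⁻¹] → ℂ` injective, for the polydisc presentation of
Def. 6/10), stronger than the item on cube classes (smaller relation module) and external to the tree's
calculus; all the transcendence weight sits in S2, S1 is theorem-type (Hironaka / rectilinearisation).

Registered stubs (2): `stub_cubeNashNormalForm` (= item 3574 of LiftingCriteria BY NAME),
`stub_ayoubConjectureSeven`. Proved (no `sorry` outside the stubs): `ayoubIdeal_le_relations`,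
`exists_isKappa`, `resolved_of_S1`, `piIterate_mem_relations_of_kappaIterate` (transport `[κ]^N ⇝ [π]^N`
along `c ≡ a`, relations a two-sided ideal — landed `mul_mem_relations_left/right_holds`),
`piLocalKernel_of : KZ.PiLocalKernel`, and `AyoubPiLocalKernel_of` (the item by name, through the landed
dictionary `KernelForm.LocaliseAtValuePrime.ayoubPiLocalKernel_iff_piLocalKernel`).
Stub probes (strategist folder bc/): S1 → S, S2 → S, S2 → item all fail `first | exact? | simpa | aesop`.
-/

noncomputable section

set_option linter.dupNamespace false

namespace Summit.KontsevichZagierPeriods.KontsevichZagierPeriods.Cruxes.MultiCoVKernel.PiCutLocalKernel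

open Set MeasureTheory
open Literature.NumberTheory.Transcendental
open Literature.NumberTheory.Transcendental.KZ hiding cubicalSpan
open Summit.KontsevichZagierPeriods.FurushoPentagon.ReducedPeriodRing (unitCube cubicalGens cubicalSpan)
open Summit.KontsevichZagierPeriods.FurushoPentagon.SectorToKernel
  (cubeResolution_of_cubeNashNormalForm leaves_cubeNormalForm resolvedRing_mul_mem_cubicalSpan)
open Summit.KontsevichZagierPeriods.HurwitzMicroSectors.NormalFormPrinciple.PiBox
  (exists_kappa stub_piCalibration)

/-! ## Ayoub's presentation (real form) and the localising kernel `κ` -/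

/-- **Ayoub's relation module (real form)**: generated by ℚ-linearity of the integrand on a cube
(`KZ.cubicalLinGens`) and the Stokes relations (`KZ.cubicalStokesGens`). [cite: Ayoub2014, Def. 10] -/
def ayoubIdeal : AddSubgroup FormalRep :=
  AddSubgroup.closure (KZ.cubicalLinGens ∪ KZ.cubicalStokesGens)

/-- Soundness of Ayoub's presentation inside the rules: `ayoubIdeal ≤ KZ.relations`
(`KZ.cubicalLinGens_subset_relations`, `KZ.cubicalStokesGens_subset_relations`). [cite: Ayoub2014, Def. 10] -/
theorem ayoubIdeal_le_relations : ayoubIdeal ≤ relations := by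
  refine (AddSubgroup.closure_le _).mpr ?_
  rintro x (hx | hx)
  · exact KZ.cubicalLinGens_subset_relations hx
  · exact KZ.cubicalStokesGens_subset_relations hx

/-- The localising element `κ = [[0,1], du/((1−u)²+u²)]` (value `π/2`), pinned by domain and integrand.
[cite: KontsevichZagier2001, §1.1] -/
def IsKappa (κ : IntegralRep 1) : Prop :=
  κ.domain = {x | x 0 ∈ Set.Icc (0:ℝ) 1} ∧ κ.integrand = (fun x => 1 / ((1 - x 0) ^ 2 + x 0 ^ 2))

/-- `κ` exists (landed `exists_kappa`). [folklore] -/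
theorem exists_isKappa : ∃ κ : IntegralRep 1, IsKappa κ := exists_kappa

/-! ## Registered stubs (open) -/

/-- **S1 (cube-Nash normal form) = item stmt-KontsevichZagierPeriods-3574 of route LiftingCriteria, by
name.** Every difference of KZ-rational representations is KZ-equivalent to a `ℤ`-combination of tame
cube classes. Theorem-grade (semialgebraic triangulation + embedded resolution + ramified substitutions,
all realised by moves; Hironaka strength). [cite: HuberMullerStachPeriods2017, §12.1; Ayoub2014, Rem. 12] -/
theorem stub_cubeNashNormalForm :
    Summit.KontsevichZagierPeriods.KontsevichZagierPeriods.Theses.LiftingCriteria.CubeNashNormalForm := by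
  sorry

/-- **S2 (Ayoub's Conjecture 7 in Ayoub's presentation, real form; hardest — period-conjecture
strength).** A `ℤ`-combination `a` of tame cube classes with `eval a = 0` lies in Ayoub's module after
finitely many left multiplications by `[κ]`: evaluation is injective on the polydisc presentation
`𝒪_alg(𝔻̄^∞) ⧸ ⟨linearity, ∂f/∂zᵢ − f|_{zᵢ=1} + f|_{zᵢ=0}⟩` localised at `2πi` (here: real parts, `κ²`
calibrating `−(2πi)²/16`). Printed OPEN ("widely open and desperately out of reach", Ayoub 2014 Rem. 8);
it is Grothendieck's period conjecture for Nori motives by Ayoub 2014 Prop. 11 + Nori's torsor theorem.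
Stronger than the item on cube classes (smaller module), not implied by it without a comparison
KZ ⇒ Ayoub; implies the item only through S1 (below). [cite: Ayoub2014, Def. 6 and Conj. 7; HuberMullerStachPeriods2017, Conj. 13.2.1] -/
theorem stub_ayoubConjectureSeven :
    ∀ κ : IntegralRep 1, IsKappa κ → ∀ a : FormalRep, a ∈ cubicalSpan → eval a = 0 →
      ∃ N : ℕ, (fun x => of κ * x)^[N] a ∈ ayoubIdeal := by
  sorry

/-! ## Proved: the composition -/

/-- Cube resolution of every formal combination, from S1 (landed `cubeResolution_of_cubeNashNormalForm`,
`leaves_cubeNormalForm`). [cite: Ayoub2014, Rem. 12] -/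
theorem resolved_of_S1
    (hS1 : Summit.KontsevichZagierPeriods.KontsevichZagierPeriods.Theses.LiftingCriteria.CubeNashNormalForm)
    (c : FormalRep) : ∃ a ∈ cubicalSpan, c - a ∈ relations :=
  leaves_cubeNormalForm (cubeResolution_of_cubeNashNormalForm hS1) c

/-- Iterates of a left multiplication commute with doubling. [folklore] -/
theorem iterate_mul_two_nsmul (g : FormalRep) (N : ℕ) (z : FormalRep) :
    (fun x => g * x)^[N] ((2:ℕ) • z) = (2:ℕ) • (fun x => g * x)^[N] z := by
  induction N generalizing z with
  | zero => rfl
  | succ N ih =>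
    rw [Function.iterate_succ_apply, Function.iterate_succ_apply, ← ih]
    congr 1
    simp only [two_nsmul, mul_add]

/-- **`[π]`-iterates versus `[κ]`-iterates**: if `x ≡ y` and `[κ]^N ⋆ y` is a relation then
`[π]^N ⋆ x` is a relation (`[π] ≡ 2[κ]`, relations are a two-sided ideal). [cite: KontsevichZagier2001, §1.1] -/
theorem piIterate_mem_relations_of_kappaIterate {κ : IntegralRep 1} (hκ : IsKappa κ) :
    ∀ (N : ℕ) (x y : FormalRep), x - y ∈ relations → (fun z => of κ * z)^[N] y ∈ relations →
      (fun z => of piRep * z)^[N] x ∈ relations := by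
  have hπκ : of piRep - (2:ℕ) • of κ ∈ relations := stub_piCalibration κ hκ.1 hκ.2
  intro N
  induction N with
  | zero =>
    intro x y hxy hy
    have := relations.add_mem hxy hy
    simpa using this
  | succ N ih =>
    intro x y hxy hy
    rw [Function.iterate_succ_apply]
    rw [Function.iterate_succ_apply] at hy
    refine ih (of piRep * x) ((2:ℕ) • (of κ * y)) ?_ ?_
    · have h1 : of piRep * x - of piRep * y ∈ relations := by
        rw [← mul_sub]; exact mul_mem_relations_left_holds _ _ hxy
      have h2 : of piRep * y - ((2:ℕ) • of κ) * y ∈ relations := by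
        rw [← sub_mul]; exact mul_mem_relations_right_holds _ _ hπκ
      have h3 : ((2:ℕ) • of κ) * y = (2:ℕ) • (of κ * y) := smul_mul_assoc _ _ _
      have := relations.add_mem h1 h2
      rw [h3] at this
      simpa using this
    · rw [iterate_mul_two_nsmul]
      exact relations.nsmul_mem hy 2

/-- **The composition, closed form**: S1 ∧ S2 ⇒ `KZ.PiLocalKernel`. Resolve `c ≡ a` into tame cube
classes (S1); `eval a = eval c = 0` by SOUNDNESS of the rules (`relations_le_ker_eval_holds` — the one
place the hypothesis `eval c = 0` is used, and why no comparison KZ ⇒ Ayoub is needed); S2 puts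
`[κ]^N ⋆ a` in Ayoub's module, which lies inside the rules (`ayoubIdeal_le_relations`); transport back
along `c ≡ a` with `[π] ≡ 2[κ]`. [cite: Ayoub2014, Conj. 7] -/
theorem piLocalKernel_of
    (hS1 : Summit.KontsevichZagierPeriods.KontsevichZagierPeriods.Theses.LiftingCriteria.CubeNashNormalForm)
    (hS2 : ∀ κ : IntegralRep 1, IsKappa κ → ∀ a : FormalRep, a ∈ cubicalSpan → eval a = 0 →
      ∃ N : ℕ, (fun x => of κ * x)^[N] a ∈ ayoubIdeal) :
    KZ.PiLocalKernel := by
  intro c hc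
  obtain ⟨κ, hκ⟩ := exists_isKappa
  obtain ⟨a, ha, hca⟩ := resolved_of_S1 hS1 c
  have ha0 : eval a = 0 := by
    have h : eval (c - a) = 0 := relations_le_ker_eval_holds hca
    rwa [map_sub, hc, zero_sub, neg_eq_zero] at h
  obtain ⟨N, hN⟩ := hS2 κ hκ a ha ha0
  exact ⟨N, piIterate_mem_relations_of_kappaIterate hκ N c a hca (ayoubIdeal_le_relations hN)⟩

/-- **The item by name** (pinned `∀ P` form, = stmt-KontsevichZagierPeriods-0541), from S1 ∧ S2 through
`piLocalKernel_of` and the landed dictionary `ayoubPiLocalKernel_iff_piLocalKernel`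
(`lift (of ∘ P)`-iterates agree with `([π] * ·)`-iterates modulo relations). [cite: Ayoub2014, Conj. 7] -/
theorem AyoubPiLocalKernel_of :
    Summit.KontsevichZagierPeriods.KontsevichZagierPeriods.Theses.LiftingCriteria.CubeNashNormalForm →
    (∀ κ : IntegralRep 1, IsKappa κ → ∀ a : FormalRep, a ∈ cubicalSpan → eval a = 0 →
      ∃ N : ℕ, (fun x => of κ * x)^[N] a ∈ ayoubIdeal) →
    Summit.KontsevichZagierPeriods.KontsevichZagierPeriods.Theses.AyoubSpecialisation.AyoubPiLocalKernel :=
  fun hS1 hS2 =>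
    (Summit.KontsevichZagierPeriods.KernelForm.LocaliseAtValuePrime.ayoubPiLocalKernel_iff_piLocalKernel).mpr
      (piLocalKernel_of hS1 hS2)

/-- The item from the registered stubs. [folklore] -/
theorem AyoubPiLocalKernel_of_stubs :
    Summit.KontsevichZagierPeriods.KontsevichZagierPeriods.Theses.AyoubSpecialisation.AyoubPiLocalKernel :=
  AyoubPiLocalKernel_of stub_cubeNashNormalForm stub_ayoubConjectureSeven

end Summit.KontsevichZagierPeriods.KontsevichZagierPeriods.Cruxes.MultiCoVKernel.PiCutLocalKernel

end
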